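import Mathlib.Data.Finset.Powerset
import Mathlib.Data.Finset.Prod
import Mathlib.Data.Fintype.Powerset
import Mathlib.Algebra.BigOperators.Ring.Finset
import Mathlib.Algebra.Order.BigOperators.Group.Finset
import Mathlib.Data.Nat.Choose.Sum
import HarnessLib

/-!
# Kaibel–Weltge: the unique-disjointness covering bound `(3/2)^n`

Support file for the barrier entry `Literature.Barriers.PneNP.TSPExtensionComplexity`
(FMPTW 2015, Thm. 12: `xc(TSP(n)) ≥ 2^{Ω(√n)}`), whose discharge needs an exponential lower
bound on coverings of the unique-disjointness pattern. FMPTW (Thm. 1) import it from de Wolf /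
Razborov; we vendor instead the self-contained half-page argument of

* V. Kaibel, S. Weltge, *A short proof that the extension complexity of the correlation polytope
  grows exponentially*, Discrete Comput. Geom. 53 (2015) 397–401 = arXiv:1307.3543 (held,
  `lit read arxiv:1307.3543`, §2, PDF p. 4), proof of Thm. 1:

Let `disjpairs(n) = {(a,b) : a, b ⊆ [n], a ∩ b = ∅}` (so `|disjpairs(n)| = 3^n`). A set
`R ⊆ disjpairs(n)` is **valid** if `|a ∩ b'| ≠ 1` for all `(a,b), (a',b') ∈ R`. "It remains to
be shown that `ϱ(n) ≤ 2^n`" (the largest cardinality of a valid set), "which we will establish by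
showing that `ϱ(n) ≤ 2 ϱ(n-1)`": with
`R₁ = ({(a,b) ∈ R : n ∈ a} ∪ {(a,b) ∈ R : (a ∪ {n}, b) ∉ R}) ∩ ([n] × [n-1])`,
`R₂ = ({(a,b) ∈ R : n ∈ b} ∪ {(a,b) ∈ R : (a, b ∪ {n}) ∉ R}) ∩ ([n-1] × [n])` and
`f(a,b) = (a ∖ {n}, b ∖ {n})`, the images `f(R₁)`, `f(R₂)` are valid, `f` is injective on each
`Rᵢ`, and `R ⊆ R₁ ∪ R₂` because `(a ∪ {n}, b) ∈ R` and `(a, b ∪ {n}) ∈ R` together would give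
`|(a ∪ {n}) ∩ (b ∪ {n})| = 1`. Hence any covering of `disjpairs(n)` by valid sets has at least
`3^n / 2^n = 1.5^n` members (this is the rectangle covering number of the UDISJ matrix, §3).

**What is here.** `disjPairs U` (pairs of disjoint subsets of a finset `U`, any ambient type),
`IsKWValid`, the bound `IsKWValid.card_le_two_pow` (`|R| ≤ 2^{|U|}`, induction on `U` exactly
as printed), `card_disjPairs` (`= 3^{|U|}`), and the covering corollary in the RECTANGLE form
used downstream (`three_pow_le_card_mul_two_pow_of_cover`: if sets `RA j × RB j`, `j ∈ J`, on
which `|a ∩ b| ≠ 1`, cover all disjoint pairs, then `3^{|U|} ≤ |J| · 2^{|U|}`). Everything is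
proved; no named facts.
-/

namespace Literature.Barriers.PneNP

open Finset

variable {α : Type*} [DecidableEq α]

/-- `disjpairs(U)`: the ordered pairs `(a, b)` of DISJOINT subsets of the finite set `U`.
[cite: KaibelWeltge2014, §2 (PDF p. 4)] -/
def disjPairs (U : Finset α) : Finset (Finset α × Finset α) :=
  (U.powerset ×ˢ U.powerset).filter fun p => Disjoint p.1 p.2

/-- Membership in `disjPairs U`. [cite: KaibelWeltge2014, §2 (PDF p. 4)] -/
theorem mem_disjPairs {U : Finset α} {p : Finset α × Finset α} :
    p ∈ disjPairs U ↔ p.1 ⊆ U ∧ p.2 ⊆ U ∧ Disjoint p.1 p.2 := by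
  simp [disjPairs, and_assoc]

/-- A set `R` of pairs of sets is **valid** (Kaibel–Weltge) if `|a ∩ b'| ≠ 1` for all
`(a, b), (a', b') ∈ R` — i.e. the rectangle spanned by `R` avoids the zeros of the
unique-disjointness matrix. [cite: KaibelWeltge2014, §2 (PDF p. 4, display (1))] -/
def IsKWValid (R : Finset (Finset α × Finset α)) : Prop :=
  ∀ p ∈ R, ∀ q ∈ R, (p.1 ∩ q.2).card ≠ 1

/-- Subsets of valid sets are valid. [cite: KaibelWeltge2014, §2 (PDF p. 4)] -/
theorem IsKWValid.subset {R R' : Finset (Finset α × Finset α)} (h : IsKWValid R) (hsub : R' ⊆ R) :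
    IsKWValid R' :=
  fun p hp q hq => h p (hsub hp) q (hsub hq)

/-- **Kaibel–Weltge, proof of Thm. 1: `ϱ(n) ≤ 2^n`.** A valid set of pairs of disjoint subsets
of `U` has at most `2^{|U|}` elements (induction on `U`: `ϱ(n) ≤ 2 ϱ(n-1)` via the sets
`R₁, R₂` and the map `f(a,b) = (a ∖ {x}, b ∖ {x})`). [cite: KaibelWeltge2014, Thm. 1 (proof, PDF pp. 4–5)] -/
theorem IsKWValid.card_le_two_pow (U : Finset α) :
    ∀ R : Finset (Finset α × Finset α), IsKWValid R → R ⊆ disjPairs U → R.card ≤ 2 ^ U.card := by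
  induction U using Finset.induction_on with
  | empty =>
    intro R _ hRU
    rw [card_empty, pow_zero]
    refine card_le_one.2 fun p hp q hq => ?_
    have hp' := mem_disjPairs.1 (hRU hp)
    have hq' := mem_disjPairs.1 (hRU hq)
    simp only [subset_empty] at hp' hq'
    exact Prod.ext (hp'.1.trans hq'.1.symm) (hp'.2.1.trans hq'.2.1.symm)
  | insert x U hx ih =>
    intro R hR hRU
    -- the map `f` and the two pieces `R₁`, `R₂` of the printed proof
    let f : Finset α × Finset α → Finset α × Finset α := fun p => (p.1.erase x, p.2.erase x)
    let R₁ : Finset (Finset α × Finset α) :=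
      R.filter fun p => x ∉ p.2 ∧ (x ∈ p.1 ∨ (insert x p.1, p.2) ∉ R)
    let R₂ : Finset (Finset α × Finset α) :=
      R.filter fun p => x ∉ p.1 ∧ (x ∈ p.2 ∨ (p.1, insert x p.2) ∉ R)
    have hR₁ : ∀ p, p ∈ R₁ ↔ p ∈ R ∧ x ∉ p.2 ∧ (x ∈ p.1 ∨ (insert x p.1, p.2) ∉ R) := fun p => by
      simp only [R₁, mem_filter]
    have hR₂ : ∀ p, p ∈ R₂ ↔ p ∈ R ∧ x ∉ p.1 ∧ (x ∈ p.2 ∨ (p.1, insert x p.2) ∉ R) := fun p => by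
      simp only [R₂, mem_filter]
    -- `R ⊆ R₁ ∪ R₂`
    have hcover : R ⊆ R₁ ∪ R₂ := by
      intro p hp
      have hpU := mem_disjPairs.1 (hRU hp)
      rw [mem_union, hR₁, hR₂]
      by_cases h1 : x ∈ p.1
      · exact Or.inl ⟨hp, fun h2 => disjoint_left.1 hpU.2.2 h1 h2, Or.inl h1⟩
      by_cases h2 : x ∈ p.2
      · exact Or.inr ⟨hp, h1, Or.inl h2⟩
      by_cases hA : (insert x p.1, p.2) ∈ R
      · by_cases hB : (p.1, insert x p.2) ∈ R
        · exfalso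
          refine hR _ hA _ hB (card_eq_one.2 ⟨x, eq_singleton_iff_unique_mem.2 ⟨by simp, ?_⟩⟩)
          intro y hy
          simp only [mem_inter, mem_insert] at hy
          rcases hy with ⟨rfl | hy1, hy2⟩
          · rfl
          · rcases hy2 with rfl | hy2
            · rfl
            · exact absurd hy2 (disjoint_left.1 hpU.2.2 hy1)
        · exact Or.inr ⟨hp, h1, Or.inr hB⟩
      · exact Or.inl ⟨hp, h2, Or.inr hA⟩
    -- `f` is injective on `R₁` and on `R₂`
    have hinj₁ : Set.InjOn f R₁ := by
      intro p hp p' hp' hfe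
      rw [mem_coe, hR₁] at hp hp'
      obtain ⟨hpR, hx2, hor⟩ := hp
      obtain ⟨hp'R, hx2', hor'⟩ := hp'
      simp only [f, Prod.mk.injEq] at hfe
      obtain ⟨hfe1, hfe2⟩ := hfe
      have h2 : p.2 = p'.2 := by
        rwa [erase_eq_of_notMem hx2, erase_eq_of_notMem hx2'] at hfe2
      have h1 : p.1 = p'.1 := by
        by_cases hx1 : x ∈ p.1 <;> by_cases hx1' : x ∈ p'.1
        · rw [← insert_erase hx1, ← insert_erase hx1', hfe1]
        · exfalso
          rcases hor' with h | h
          · exact hx1' h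
          · rw [erase_eq_of_notMem hx1'] at hfe1
            apply h
            rw [← hfe1, insert_erase hx1, ← h2]
            exact hpR
        · exfalso
          rcases hor with h | h
          · exact hx1 h
          · rw [erase_eq_of_notMem hx1] at hfe1
            apply h
            rw [hfe1, insert_erase hx1', h2]
            exact hp'R
        · rwa [erase_eq_of_notMem hx1, erase_eq_of_notMem hx1'] at hfe1
      exact Prod.ext h1 h2
    have hinj₂ : Set.InjOn f R₂ := by
      intro p hp p' hp' hfe
      rw [mem_coe, hR₂] at hp hp'
      obtain ⟨hpR, hx1, hor⟩ := hp
      obtain ⟨hp'R, hx1', hor'⟩ := hp'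
      simp only [f, Prod.mk.injEq] at hfe
      obtain ⟨hfe1, hfe2⟩ := hfe
      have h1 : p.1 = p'.1 := by
        rwa [erase_eq_of_notMem hx1, erase_eq_of_notMem hx1'] at hfe1
      have h2 : p.2 = p'.2 := by
        by_cases hx2 : x ∈ p.2 <;> by_cases hx2' : x ∈ p'.2
        · rw [← insert_erase hx2, ← insert_erase hx2', hfe2]
        · exfalso
          rcases hor' with h | h
          · exact hx2' h
          · rw [erase_eq_of_notMem hx2'] at hfe2
            apply h
            rw [← hfe2, insert_erase hx2, ← h1]
            exact hpR
        · exfalso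
          rcases hor with h | h
          · exact hx2 h
          · rw [erase_eq_of_notMem hx2] at hfe2
            apply h
            rw [hfe2, insert_erase hx2', h1]
            exact hp'R
        · rwa [erase_eq_of_notMem hx2, erase_eq_of_notMem hx2'] at hfe2
      exact Prod.ext h1 h2
    -- the images live over `U`
    have himgU : ∀ p ∈ R, f p ∈ disjPairs U := by
      intro p hpR
      have hpU := mem_disjPairs.1 (hRU hpR)
      rw [mem_disjPairs]
      refine ⟨?_, ?_, hpU.2.2.mono (erase_subset _ _) (erase_subset _ _)⟩
      · intro y hy
        obtain ⟨hyx, hy1⟩ := mem_erase.1 hy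
        exact (mem_insert.1 (hpU.1 hy1)).resolve_left hyx
      · intro y hy
        obtain ⟨hyx, hy2⟩ := mem_erase.1 hy
        exact (mem_insert.1 (hpU.2.1 hy2)).resolve_left hyx
    have himg₁ : R₁.image f ⊆ disjPairs U := by
      intro q hq
      obtain ⟨p, hp, rfl⟩ := mem_image.1 hq
      exact himgU p ((hR₁ p).1 hp).1
    have himg₂ : R₂.image f ⊆ disjPairs U := by
      intro q hq
      obtain ⟨p, hp, rfl⟩ := mem_image.1 hq
      exact himgU p ((hR₂ p).1 hp).1
    -- the images are valid
    have hval₁ : IsKWValid (R₁.image f) := by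
      intro q hq q' hq'
      obtain ⟨p, hp, rfl⟩ := mem_image.1 hq
      obtain ⟨p', hp', rfl⟩ := mem_image.1 hq'
      obtain ⟨hpR, -, -⟩ := (hR₁ p).1 hp
      obtain ⟨hp'R, hx2', -⟩ := (hR₁ p').1 hp'
      simp only [f]
      rw [erase_eq_of_notMem hx2', erase_inter,
        erase_eq_of_notMem fun h => hx2' (mem_inter.1 h).2]
      exact hR p hpR p' hp'R
    have hval₂ : IsKWValid (R₂.image f) := by
      intro q hq q' hq'
      obtain ⟨p, hp, rfl⟩ := mem_image.1 hq
      obtain ⟨p', hp', rfl⟩ := mem_image.1 hq'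
      obtain ⟨hpR, hx1, -⟩ := (hR₂ p).1 hp
      obtain ⟨hp'R, -, -⟩ := (hR₂ p').1 hp'
      simp only [f]
      rw [erase_eq_of_notMem hx1, inter_erase,
        erase_eq_of_notMem fun h => hx1 (mem_inter.1 h).1]
      exact hR p hpR p' hp'R
    -- count
    calc R.card ≤ (R₁ ∪ R₂).card := card_le_card hcover
      _ ≤ R₁.card + R₂.card := card_union_le _ _
      _ = (R₁.image f).card + (R₂.image f).card := by
          rw [card_image_of_injOn hinj₁, card_image_of_injOn hinj₂]
      _ ≤ 2 ^ U.card + 2 ^ U.card := Nat.add_le_add (ih _ hval₁ himg₁) (ih _ hval₂ himg₂)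
      _ = 2 ^ (insert x U).card := by rw [card_insert_of_notMem hx]; ring

/-- The fibre of `disjPairs U` over a first component `a ⊆ U` is `{a} × 𝒫(U ∖ a)`. [folklore] -/
theorem disjPairs_filter_fst_eq {U : Finset α} {a : Finset α} (ha : a ⊆ U) :
    (disjPairs U).filter (fun p => p.1 = a) = (U \ a).powerset.image fun b => (a, b) := by
  ext p
  simp only [mem_filter, mem_image, mem_powerset, mem_disjPairs]
  constructor
  · rintro ⟨⟨_, h2, h3⟩, rfl⟩
    refine ⟨p.2, fun y hy => mem_sdiff.2 ⟨h2 hy, fun hy1 => disjoint_left.1 h3 hy1 hy⟩, rfl⟩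
  · rintro ⟨b, hb, rfl⟩
    exact ⟨⟨ha, fun y hy => (mem_sdiff.1 (hb hy)).1, disjoint_of_subset_right hb disjoint_sdiff⟩,
      rfl⟩

/-- **`|disjpairs(n)| = 3^n`** ("for each `i ∈ [n]` independently one has to choose between three
possibilities"). Here: summing the fibres `2^{|U ∖ a|}` over `a ⊆ U` and the binomial theorem.
[cite: KaibelWeltge2014, Thm. 1 (proof, PDF p. 4)] -/
theorem card_disjPairs (U : Finset α) : (disjPairs U).card = 3 ^ U.card := by
  rw [card_eq_sum_card_fiberwise (f := Prod.fst) (t := U.powerset)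
    (fun p hp => mem_powerset.2 (mem_disjPairs.1 (mem_coe.1 hp)).1)]
  have hfib : ∀ a ∈ U.powerset,
      ((disjPairs U).filter (fun p => p.1 = a)).card = 2 ^ (U.card - a.card) := by
    intro a ha
    rw [mem_powerset] at ha
    rw [disjPairs_filter_fst_eq ha, card_image_of_injective _ fun b b' h => (Prod.ext_iff.1 h).2,
      card_powerset, card_sdiff_of_subset ha]
  rw [sum_congr rfl hfib, Finset.sum_powerset_apply_card (fun k => 2 ^ (U.card - k)),
    show (3 : ℕ) = 1 + 2 from rfl, add_pow]
  refine sum_congr rfl fun k _ => ?_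
  rw [nsmul_eq_mul, Nat.cast_id, one_pow, one_mul, mul_comm]

/-- **Covering corollary, rectangle form** ("any covering of `disjpairs(n)` must have size at
least `|disjpairs(n)| / ϱ(n)`"): if finitely many "rectangles" `RA j × RB j` (`j ∈ J`), each
avoiding the pairs with `|a ∩ b| = 1`, together contain every pair of disjoint subsets of `U`,
then `3^{|U|} ≤ |J| · 2^{|U|}`. [cite: KaibelWeltge2014, Thm. 1 and §3 (PDF pp. 4, 6)] -/
theorem three_pow_le_card_mul_two_pow_of_cover {ι : Type*} (U : Finset α) (J : Finset ι)
    (RA RB : ι → Set (Finset α))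
    (hfree : ∀ j ∈ J, ∀ a ∈ RA j, ∀ b ∈ RB j, (a ∩ b).card ≠ 1)
    (hcover : ∀ a b : Finset α, a ⊆ U → b ⊆ U → Disjoint a b → ∃ j ∈ J, a ∈ RA j ∧ b ∈ RB j) :
    3 ^ U.card ≤ J.card * 2 ^ U.card := by
  classical
  let R : ι → Finset (Finset α × Finset α) := fun j =>
    (disjPairs U).filter fun p => p.1 ∈ RA j ∧ p.2 ∈ RB j
  have hval : ∀ j ∈ J, IsKWValid (R j) := fun j hj p hp q hq =>
    hfree j hj _ (mem_filter.1 hp).2.1 _ (mem_filter.1 hq).2.2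
  have hsub : ∀ j, R j ⊆ disjPairs U := fun j => filter_subset _ _
  have hcov : disjPairs U ⊆ J.biUnion R := by
    intro p hp
    obtain ⟨h1, h2, h3⟩ := mem_disjPairs.1 hp
    obtain ⟨j, hj, ha, hb⟩ := hcover p.1 p.2 h1 h2 h3
    exact mem_biUnion.2 ⟨j, hj, mem_filter.2 ⟨hp, ha, hb⟩⟩
  calc 3 ^ U.card = (disjPairs U).card := (card_disjPairs U).symm
    _ ≤ (J.biUnion R).card := card_le_card hcov
    _ ≤ ∑ j ∈ J, (R j).card := card_biUnion_le
    _ ≤ ∑ j ∈ J, 2 ^ U.card :=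
        sum_le_sum fun j hj => IsKWValid.card_le_two_pow U (R j) (hval j hj) (hsub j)
    _ = J.card * 2 ^ U.card := by rw [sum_const, nsmul_eq_mul, Nat.cast_id]

/-- The same over a finite ambient type (`U = univ`, e.g. subsets of `Fin n`): rectangles free of
`|a ∩ b| = 1` covering all disjoint pairs number at least `(3/2)^{|α|}`, stated as
`3^{|α|} ≤ |J| · 2^{|α|}`. [cite: KaibelWeltge2014, Thm. 1 and §3 (PDF pp. 4, 6)] -/
theorem three_pow_le_card_mul_two_pow_of_cover_univ {ι : Type*} [Fintype α] (J : Finset ι)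
    (RA RB : ι → Set (Finset α))
    (hfree : ∀ j ∈ J, ∀ a ∈ RA j, ∀ b ∈ RB j, (a ∩ b).card ≠ 1)
    (hcover : ∀ a b : Finset α, Disjoint a b → ∃ j ∈ J, a ∈ RA j ∧ b ∈ RB j) :
    3 ^ Fintype.card α ≤ J.card * 2 ^ Fintype.card α := by
  rw [← Finset.card_univ]
  exact three_pow_le_card_mul_two_pow_of_cover univ J RA RB hfree
    fun a b _ _ hab => hcover a b hab

end Literature.Barriers.PneNP
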